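import Literature.NumberTheory.EllipticCurves.CaiLiZhai2019.TwoPartBSDQuadraticTwists
import HarnessLib

/-!
# Shu–Zhai 2021 (Crelle 775), *Generalized Birch lemma and the 2-part of the Birch and Swinnerton-Dyer conjecture for certain elliptic curves*: (Tor), admissible primes, Thm. 1.2, Cor. 1.3, Thm. 1.4 and Thm. 4.10 AS PRINTED

HONEST FRAMING (cell `b2b-bsdres`, sub-lane `bsd-p2`, run/shared/lean/b2b/bsd-rank1-residual/p2/;
literature typer 1, mandate (iv); lead decisions I2-8 / L-OW: the Shu–Zhai facts are lit-1's "F5"):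
PUBLISHED theorems vendored as named `Prop`s (nothing asserted, nothing discharged; D-0014), every
printed hypothesis a binder, locators into the held text. EVIDENCE of what print says at `p = 2`:
a rank-ZERO and rank-ONE quadratic-twist statement of the `2`-adic valuation of `L^{(r)}/(Ω R)`
and a transport of the `2`-part of BSD, for optimal curves with `E(ℚ)[2] ≅ ℤ/2ℤ`. Nothing booked;
no mark moved.

Source. J. Shu, S. Zhai, *Generalized Birch lemma and the 2-part of the Birch and Swinnerton-Dyer
conjecture for certain elliptic curves*, J. reine angew. Math. **775** (2021), 117–143,
doi:10.1515/crelle-2021-0004 = arXiv:2102.11808 [ShuZhai2021]. Text read: the held LaTeX-derived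
text `paper:arxiv-2102.11808` (chunks; locators = `chunk:line`; §1 = chunk p0003, §4.3 = chunk
p0013).

## The printed statements (verbatim)

* Standing (p0003 L3–L4): "we let `f : X₀(N) → E` be an optimal modular parametrization sending
  the cusp at infinity … to the zero element of `E`. We write `[0]` for the cusp of `X₀(N)`
  arising from the zero point in `ℙ¹(ℚ)` … By the theorem of Manin–Drinfeld, `f([0])` is a
  torsion point in `E(ℚ)`. For any square-free integer `D ≠ 1`, we write `E^{(D)}` for the twist
  of `E` by the extension `ℚ(√D)/ℚ` … We assume throughout this paper that the group `E[2](ℚ)`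
  of rational 2-division points on `E` is cyclic of order 2, and we define the elliptic curve
  `E′/ℚ` to be the quotient curve `E′ = E/E[2](ℚ)`."
* **(Tor)** (p0003 L6): "`E[2](ℚ) = E′[2](ℚ) = ℤ/2ℤ`." (L8: "Thus `ℚ(E[2])` and `ℚ(E′[2])` are
  quadratic extensions of `ℚ`." L8–L14, Prop. (Hecke4): for `E` with `f([0]) ∉ 2E(ℚ)`, (Tor) holds
  iff there is an odd prime `q` of good reduction with `a_q ≡ 1 − (−1/q) (mod 4)` — display
  (hecke), L10–L12.)
* **Definition 1.1** (p0003 L17–L18): "A prime `q` is admissible for `E` if `(q, 2N) = 1` and `q`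
  is inert in both of the quadratic fields `ℚ(E[2])` and `ℚ(E′[2])`." (L20, Prop. (Hecke3): under
  (Tor) an odd good prime `q` is admissible iff it satisfies (hecke).)
* Standing (p0003 L22): "`p` will always denote a prime `> 3` such that `p ≡ 3 mod 4`, and we
  will write `K = ℚ(√−p)`. We say that `p` satisfies Heegner hypothesis for `(E, K)` if every
  prime `ℓ` dividing `N` splits in the field `K`. For any odd prime `q`, put `q* = (−1/q) q`."
* **Theorem 1.2** (p0003 L24–L32): "Let `E` be an elliptic curve over `ℚ` satisfying
  `f([0]) ∉ 2E(ℚ)` and Condition (Tor). Let `p > 3` be any prime `≡ 3 mod 4` satisfying the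
  Heegner hypothesis for `(E, K)`, where `K = ℚ(√−p)`. For any integer `r ≥ 0`, let `q₁, …, q_r`
  be distinct admissible primes which are not equal to `p`, and put `M = q₁* q₂* ⋯ q_r*`. Then we
  have `ord_{s=1} L(E^{(M)}, s) = rk E^{(M)}(ℚ) = 0`, and `ord_{s=1} L(E^{(−pM)}, s) =
  rk E^{(−pM)}(ℚ) = 1`. Moreover, the Shafarevich–Tate groups `Ш(E^{(M)})` and `Ш(E^{(−pM)})` are
  both finite."
* **Corollary 1.3** (p0003 L36–L38): "Let `E` be any elliptic curve over `ℚ` such that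
  `f([0]) ∉ 2E(ℚ)`, and there exists an odd prime `q` of good reduction for `E` satisfying (hecke).
  Then, for any integer `r ≥ 1`, there exist infinitely many square-free integers `M` and `M′`,
  having exactly `r` prime factors, such that `L(E^{(M)}, s)` does not vanish at `s = 1`, and
  `L(E^{(M′)}, s)` has a zero of order `1` at `s = 1`."
* **Theorem 1.4** (p0003 L44–L45): "Let `E` and `M` be as in Theorem 1.2. Assume that (i) the
  Manin constant of `E` is odd, and (ii) every prime `ℓ` dividing `2N` splits in both `K = ℚ(√−p)`
  and `ℚ(√M)`. Then, if the `2`-part of the Birch and Swinnerton-Dyer conjecture holds for `E`, it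
  also holds for both `E^{(M)}` and `E^{(−pM)}`."
* **Theorem 4.10** (p0013 L14–L26; the body of Thm. 1.4): "Let `E`, `p` and `M` be as in Theorem
  1.2 and suppose that all the prime factors of `2N` split in `ℚ(√M)`, `p ≡ −1 mod 8` and `E` has
  odd Manin constant. Then we have `ord_{s=1} L(E^{(M)},s) = rk E^{(M)}(ℚ) = 0`, and
  `ord_{s=1} L(E^{(−pM)},s) = rk E^{(−pM)}(ℚ) = 1`;
  `ord₂(L(E^{(M)},1)/Ω_{E^{(M)}}) = r − 1`, and `ord₂(L′(E^{(−pM)},1)/Ω_{E^{(−pM)}} R(E^{(−pM)})) = r`.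
  Moreover, the Shafarevich–Tate groups `Ш(E^{(M)})` and `Ш(E^{(−pM)})` are both finite of odd
  cardinalities. If the `2`-part of the Birch and Swinnerton-Dyer conjecture holds for `E`, then
  the `2`-part of the Birch and Swinnerton-Dyer conjecture holds for both `E^{(M)}` and
  `E^{(−pM)}`." Here (p0013 L6–L12, display (fbsd)) `L^{(r_an)}(E,1)/(r_an! Ω_E R(E)) =
  ∏_ℓ c_ℓ(E)·|Ш(E)|/|E(ℚ)_tor|²`, "`R(E)` is the regulator formed with the Néron–Tate pairing …
  `R(E) = 1` when `r_an = 0`, and `R(E) = ĥ_ℚ(P)` when `r_an = 1`", and `Ω_E = ∫_{E(ℝ)}|ω_E|` is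
  "the one appearing in the exact formula" (chunk p0006 L34–L38; `= Ω⁺` or `2Ω⁺`).

## The `p = 2` flag of this file

Natively AT 2; no parity / image-surjectivity / reduction-type exclusion at `2`; BOTH analytic
ranks: `E^{(M)}` (rank `0`) and `E^{(−pM)}` (rank `1`). Restricting hypotheses: `E` OPTIMAL, the
standing `E[2](ℚ) ≅ ℤ/2ℤ`, `f([0]) ∉ 2E(ℚ)` (forces `L(E,1) ≠ 0`), (Tor), `p > 3`, `p ≡ 3 (mod 4)`,
Heegner hypothesis for `(E, ℚ(√−p))`, admissible `qᵢ ≠ p`; for the `2`-adic valuations / the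
`2`-part: odd Manin constant, `p ≡ 7 (mod 8)` (i.e. `2` split in `ℚ(√−p)`), every `ℓ ∣ 2N` split in
`ℚ(√M)`; the BSD(2) transport assumes BSD(2) for `E` itself.

## Transcription (tree dictionary)

* `E` optimal with parametrisation `f` = a globally minimal `W` with a datum
  `Dt : ModularParametrizationData W N`, `N = W.conductorNorm ℤ`, satisfying the LATTICE EQUALITY
  `Λ_E ⊆ c Λ_f` (`IsOptimalDatum`; the rendering of "`X₀(N)`-optimal" used in
  `ManinConstantSemistablePrimewise` and `CaiLiZhai2019.IsOptimalDatumWithOddManinConstant`);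
  "the Manin constant of `E` is odd" = `¬ 2 ∣ Dt.c`.
* `f([0])`: the datum's map is `φ(τ) = uniformize (c · 2πi∫_{i∞}^τ f)` (`ModularParametrizationData.φ`,
  `eichlerIntegral`); its value at the cusp `0` is `uniformize (c · {∞,0}_f)` with
  `{∞,0}_f = modularSymbol f 0 = 2πi∫_{i∞}^0 f` (`ModularSymbols`, same orientation; `= L(f,1)`):
  `cuspZeroImage`. "`f([0]) ∉ 2E(ℚ)`" = no `Q ∈ E(ℚ)` (a point of `W.baseChange ℚ`, read in `E(ℂ)`
  along `ℚ → ℂ`) has `2Q = f([0])` (`CuspZeroNotInTwice`; insensitive to the sign of `f`).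
* `E′ = E/E[2](ℚ)`: any `W′` with a `ℚ`-isogeny `W → W′` of degree `2` (`Isogeny.degree`, the order
  of the kernel on geometric points; under the standing assumption its kernel is `E[2](ℚ)`).
  (Tor) = `#E(ℚ)[2] = 2 ∧ #E′(ℚ)[2] = 2`.
* "`q` inert in `ℚ(E[2])`": with `E[2](ℚ) ≅ ℤ/2ℤ` the `2`-division field of `E` is `ℚ(√Δ_E)` (one
  rational root of the `2`-division cubic; the other two generate `ℚ(√disc) = ℚ(√Δ_E)`), and
  likewise `ℚ(E′[2]) = ℚ(√Δ_{E′})`; "inert" = `q𝓞_F` is a prime ideal for every quadratic number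
  field `F ∋ √Δ` (`IsInertInSqrt`, agreeing with `CaiLiZhai2019.IsInertIn` on integers:
  `isInertInSqrt_intCast`; `Δ` of any model — it changes by a `12`-th power).
* `q* = (−1/q) q` (`qStar`); `M = ∏_{q ∈ Q} q*` over a finite set `Q` of admissible primes `≠ p`,
  `r = #Q ≥ 0`.
* "every prime `ℓ ∣ n` splits in `ℚ(√D)`" (`AllPrimesSplitInSqrt n D`): the tree's
  `SatisfiesHeegnerHypothesis n F` ("every prime `p ∣ n` splits in `F`", `HeegnerPoints`) for every
  quadratic number field `F` containing `√D`; for `D` a rational square (`ℚ(√D) = ℚ`, only `M = 1`,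
  i.e. `r = 0`, occurs) the condition is read as empty.
* `E^{(M)}`, `E^{(−pM)}`: globally minimal models of the tree's `quadraticTwist` by `M`, `−pM`
  (`CaiLiZhai2019` pattern); "rk" = `mordellWeilRank`, "`ord_{s=1}`" = `analyticRank`,
  `L(·,1)` = `entireLFunction · 1`, `L^{(r)}(·,1)/r!` = `leadingLCoeff`, `Ω_·` = `realPeriodRat`
  (`= ∫_{E(ℝ)}|ω|` on a globally minimal model), `R(·)` = `regulator` (the Néron–Tate regulator in
  the BSD normalisation of (fbsd), `Regulator.lean`), `Ш` = `WeierstrassCurve.sha`; "the `2`-part of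
  BSD holds for `·`" = `CaiLiZhai2019.pPartBSD · 2`.
No `_holds` expected (generalised Birch lemma via Heegner points over `ℚ(√−p, √q₁*, …)`,
Gross–Zagier in the explicit form of Cai–Shu–Tian (Algebra Number Theory 8 (2014), the paper's
[CST14], §3.2 chunk p0010 L70), Kolyvagin; `2`-part by modular-symbol and `2`-Selmer computations
and [Zhai 2016]).

Dependencies in print (what the printed PROOFS cite beyond the above; recorded, nothing asserted).
Two auxiliary steps of Thm. 1.2 — the torsion lemma `E[4](𝔽_q) = E[4](ℚ_q) = ℤ/2ℤ` for `q`
inert in both fields (chunk p0005 L58) and "By [Zhaint], we already know that `L(E^{(M)},1) ≠ 0`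
and hence its root number `(M/−N) = 1`" in the sign computation (chunk p0010 L15) — and the
`E^{(M)}` valuation in the proof of Thm. 4.10 ("By Proposition (inv) and [Zhaint], both sides of
`BSD(E^{(M)})` have `2`-adic valuation `r − 1`", chunk p0013 L35) cite the paper's "[Zhaint]"
= S. Zhai, *The Birch–Swinnerton-Dyer exact formula for quadratic twists of elliptic curves*,
listed in the bibliography (chunk p0016 L101) as a 2020 preprint; it is arXiv:2102.11798, held
and typed in the tree as `Zhai2021/TwoAdicLowerBoundTwists.lean`, and has since appeared in
Pure Appl. Math. Q. (2025), doi:10.4310/pamq.250710201739 [Zhai2021BSDExactFormulaTwists] — so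
every input of Thm. 1.2 / 1.4 / 4.10 is in print. The paper's "[Wannt]" (X. Wan, arXiv:1411.6352,
preprint) is used ONLY for the full-BSD examples of §5.3 (chunk p0003 L47: "by combining this
result with a recent theorem of Wan … on the `p`-part … for primes `p > 2`"), which this file
does NOT vendor; Thm. 1.2, Cor. 1.3, Thm. 1.4 and Thm. 4.10 do not depend on it.

## References
* [ShuZhai2021] Crelle 775 (2021) 117–143 = arXiv:2102.11808: §1 (chunk p0003) (Tor), Def. 1.1,
  Thm. 1.2, Cor. 1.3, Thm. 1.4; §4.3 (chunk p0013) (fbsd), Thm. 4.10; chunk p0006 L34–L38 (`Ω`).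
* [Zhai2021BSDExactFormulaTwists] S. Zhai, arXiv:2102.11798 = Pure Appl. Math. Q. (2025),
  doi:10.4310/pamq.250710201739 (the paper's [Zhaint]; a dependency of the printed proofs, chunks
  p0005 L58, p0010 L15, p0013 L35; tree file `Zhai2021/TwoAdicLowerBoundTwists.lean`).
* [CaiLiZhai2019] (tree file `CaiLiZhai2019/TwoPartBSDQuadraticTwists.lean`: `pPartBSD`,
  `IsInertIn`, the `E′`/optimality renderings).
-/

noncomputable section

open scoped Classical MatrixGroups ModularForm

open CongruenceSubgroup NumberField WeierstrassCurve Literature.NumberTheory.EllipticCurves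
  Literature.NumberTheory.EllipticCurves.ModularForms
  Literature.NumberTheory.EllipticCurves.CaiLiZhai2019

namespace Literature.NumberTheory.EllipticCurves.ShuZhai2021

/-! ### §1. Vocabulary (definitions with bodies; nothing asserted) -/

/-- "`E` is optimal" for a globally minimal `W` with parametrisation datum `Dt`: the lattice
inclusion `Λ_E ⊆ c Λ_f` (with the structure field `c Λ_f ⊆ Λ_E`: `Λ_E = c Λ_f`), the tree's
rendering of `X₀(N)`-optimality (`ManinConstantSemistablePrimewise`,
`CaiLiZhai2019.IsOptimalDatumWithOddManinConstant`).
[cite: ShuZhai2021, §1 ("an optimal modular parametrization", chunk p0003 L3)] -/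
def IsOptimalDatum (W : WeierstrassCurve ℚ) {N : ℕ} [NeZero N]
    (Dt : ModularParametrizationData W N) : Prop :=
  ∀ z ∈ Dt.L.lattice, ∃ w ∈ periodLattice Dt.f, z = Dt.c * w

/-- `CaiLiZhai2019.IsOptimalDatumWithOddManinConstant` is `IsOptimalDatum` plus "the Manin constant
is odd" (by definition). [cite: ShuZhai2021, Thm. 1.4 (i) (chunk p0003 L45)] -/
theorem isOptimalDatumWithOddManinConstant_iff (W : WeierstrassCurve ℚ) {N : ℕ} [NeZero N]
    (Dt : ModularParametrizationData W N) :
    IsOptimalDatumWithOddManinConstant W Dt ↔ IsOptimalDatum W Dt ∧ ¬ (2 : ℤ) ∣ Dt.maninConstant :=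
  Iff.rfl

/-- The image `f([0]) ∈ E(ℂ)` of the cusp `[0]` under the parametrisation of the datum `Dt`:
`uniformize (c · {∞,0}_f)`, `{∞,0}_f = modularSymbol f 0 = 2πi ∫_{i∞}^0 f(z) dz` (the value at the
cusp `0` of `Dt.φ(τ) = uniformize (c · 2πi∫_{i∞}^τ f)`; a torsion point of `E(ℚ)` by Manin–Drinfeld).
[cite: ShuZhai2021, §1 (chunk p0003 L3: "f([0]) is a torsion point in E(ℚ)")] -/
def cuspZeroImage (W : WeierstrassCurve ℚ) {N : ℕ} [NeZero N]
    (Dt : ModularParametrizationData W N) : (W.baseChange ℂ).toAffine.Point :=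
  Dt.uniformize ((Dt.c : ℂ) * modularSymbol Dt.f 0)

/-- "`f([0]) ∉ 2E(ℚ)`": no rational point `Q ∈ E(ℚ)` (read in `E(ℂ)`) has `2Q = f([0])`.
[cite: ShuZhai2021, Thm. 1.2 hypothesis (chunk p0003 L25)] -/
def CuspZeroNotInTwice (W : WeierstrassCurve ℚ) {N : ℕ} [NeZero N]
    (Dt : ModularParametrizationData W N) : Prop :=
  ¬ ∃ Q : (W.baseChange ℚ).toAffine.Point,
      cuspZeroImage W Dt = (2 : ℕ) • WeierstrassCurve.Affine.Point.map (Algebra.ofId ℚ ℂ) Q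

/-- "`q` is inert in the quadratic field `ℚ(√Δ)`" (`Δ ∈ ℚ`): in every quadratic number field `F`
containing a square root of `Δ`, the ideal `q𝓞_F` is prime. Used with `Δ = Δ_E`, `Δ_{E′}`: with
`E[2](ℚ) ≅ ℤ/2ℤ ≅ E′[2](ℚ)`, `ℚ(E[2]) = ℚ(√Δ_E)` and `ℚ(E′[2]) = ℚ(√Δ_{E′})`.
[cite: ShuZhai2021, Def. 1.1 (chunk p0003 L17–L18) with L8 ("ℚ(E[2]) and ℚ(E′[2]) are quadratic")] -/
def IsInertInSqrt (q : ℕ) (Δ : ℚ) : Prop :=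
  ∀ (F : Type) [Field F] [NumberField F], Module.finrank ℚ F = 2 →
    (∃ x : F, x ^ 2 = algebraMap ℚ F Δ) → (Ideal.span {((q : ℤ) : 𝓞 F)}).IsPrime

/-- On integers `IsInertInSqrt` is `CaiLiZhai2019.IsInertIn`. [cite: ShuZhai2021, Def. 1.1 (chunk p0003 L17–L18)] -/
theorem isInertInSqrt_intCast (q : ℕ) (d : ℤ) : IsInertInSqrt q (d : ℚ) ↔ IsInertIn q d := by
  unfold IsInertInSqrt IsInertIn
  simp only [map_intCast]

/-- **Admissible prime** (Def. 1.1): "`q` is admissible for `E` if `(q, 2N) = 1` and `q` is inert in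
both of the quadratic fields `ℚ(E[2])` and `ℚ(E′[2])`", for a globally minimal `W` (conductor
`N = W.conductorNorm ℤ`) and a model `W′` of `E′ = E/E[2](ℚ)`.
[cite: ShuZhai2021, Def. 1.1 (chunk p0003 L17–L18)] -/
def IsAdmissible (W W' : WeierstrassCurve ℚ) (q : ℕ) : Prop :=
  q.Prime ∧ Nat.Coprime q (2 * W.conductorNorm ℤ) ∧ IsInertInSqrt q W.Δ ∧ IsInertInSqrt q W'.Δ

/-- `q* = (−1/q)·q` for an odd prime `q`: `q` if `q ≡ 1 (mod 4)`, `−q` otherwise.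
[cite: ShuZhai2021, §1 (chunk p0003 L22)] -/
def qStar (q : ℕ) : ℤ :=
  if q % 4 = 1 then (q : ℤ) else -(q : ℤ)

/-- "Every prime `ℓ ∣ n` splits in `ℚ(√D)`": for every quadratic number field `F` containing a
square root of `D`, the tree's `SatisfiesHeegnerHypothesis n F` ("every prime `p ∣ n` splits in
`F`"); read as no condition when `D` is a square (`ℚ(√D) = ℚ`; among the `M` of Thm. 1.2 only
`M = 1`). Used with `D = −p` ("Heegner hypothesis for `(E, K)`", `n = N`; `n = 2N` in Thm. 1.4 (ii))
and `D = M` (Thm. 1.4 (ii), Thm. 4.10).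
[cite: ShuZhai2021, §1 (chunk p0003 L22) and Thm. 1.4 (ii) (L45)] -/
def AllPrimesSplitInSqrt (n : ℕ) (D : ℤ) : Prop :=
  IsSquare D ∨
    ∀ (F : Type) [Field F] [NumberField F], Module.finrank ℚ F = 2 → (∃ x : F, x ^ 2 = (D : F)) →
      SatisfiesHeegnerHypothesis n F

/-- The congruence (hecke) `a_q ≡ 1 − (−1/q) (mod 4)` for an odd prime `q` of good reduction of the
globally minimal `W` (`a_q = frobeniusTrace W q = q + 1 − #Ẽ(𝔽_q)`; `(−1/q) = 1` if
`q ≡ 1 (mod 4)`, `−1` if `q ≡ 3 (mod 4)`). [cite: ShuZhai2021, §1 display (hecke) (chunk p0003 L10–L12)] -/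
def SatisfiesHecke (W : WeierstrassCurve ℚ) [W.IsGloballyMinimal] (q : ℕ) : Prop :=
  (4 : ℤ) ∣ W.frobeniusTrace q - (1 - (if q % 4 = 1 then 1 else -1))

/-- **The setting of Theorem 1.2** ("Let `E` and `M` be as in Theorem 1.2"), for a globally minimal
`W` with datum `Dt` at level `N = N_E`, a curve `W′`, a prime `p` and a finite set `Q` of primes:
the standing `E[2](ℚ) ≅ ℤ/2ℤ` with `E′ = E/E[2](ℚ)` (a degree-`2` isogeny `W → W′` over `ℚ`);
`E` optimal (`IsOptimalDatum`); `f([0]) ∉ 2E(ℚ)`; (Tor) `#E(ℚ)[2] = 2 = #E′(ℚ)[2]`; `p > 3` prime,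
`p ≡ 3 (mod 4)`, every `ℓ ∣ N` split in `ℚ(√−p)`; the elements of `Q` are admissible primes `≠ p`
(`M = ∏_{q ∈ Q} q*`, `r = #Q`).
[cite: ShuZhai2021, Thm. 1.2 hypotheses (chunk p0003 L3–L6, L17–L18, L22, L24–L25)] -/
def Thm12Setting (W : WeierstrassCurve ℚ) [NeZero (W.conductorNorm ℤ)]
    (Dt : ModularParametrizationData W (W.conductorNorm ℤ)) (W' : WeierstrassCurve ℚ) (p : ℕ)
    (Q : Finset ℕ) : Prop :=
  (∃ φ : Isogeny W W', φ.degree = 2) ∧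
  IsOptimalDatum W Dt ∧ CuspZeroNotInTwice W Dt ∧
  Nat.card {P : W.toAffine.Point // (2 : ℕ) • P = 0} = 2 ∧
  Nat.card {P : W'.toAffine.Point // (2 : ℕ) • P = 0} = 2 ∧
  p.Prime ∧ 3 < p ∧ p % 4 = 3 ∧ AllPrimesSplitInSqrt (W.conductorNorm ℤ) (-(p : ℤ)) ∧
  ∀ q ∈ Q, IsAdmissible W W' q ∧ q ≠ p

/-! ### §2. The printed theorems (named facts; nothing asserted) -/

/-- **Shu–Zhai 2021, Theorem 1.2** (verbatim in the module docstring). In the setting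
`Thm12Setting W Dt W′ p Q` (`M = ∏_{q ∈ Q} q*`, `r = #Q ≥ 0`), for globally minimal models `WM`,
`WpM` of `E^{(M)}`, `E^{(−pM)}`: `ord_{s=1} L(E^{(M)},s) = rk E^{(M)}(ℚ) = 0`,
`ord_{s=1} L(E^{(−pM)},s) = rk E^{(−pM)}(ℚ) = 1`, and `Ш(E^{(M)})`, `Ш(E^{(−pM)})` are finite.
AT 2, both ranks. No `_holds` expected.
[cite: ShuZhai2021, Thm. 1.2 (arXiv:2102.11808 chunk p0003 L24–L32)] -/
def thm12_ranks_of_twists : Prop :=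
  ∀ (W : WeierstrassCurve ℚ) [W.IsElliptic] [W.IsGloballyMinimal] [NeZero (W.conductorNorm ℤ)]
    (Dt : ModularParametrizationData W (W.conductorNorm ℤ)) (W' : WeierstrassCurve ℚ) (p : ℕ)
    (Q : Finset ℕ), Thm12Setting W Dt W' p Q →
    ∀ (WM WpM : WeierstrassCurve ℚ) [WM.IsElliptic] [WM.IsGloballyMinimal] [WpM.IsElliptic]
      [WpM.IsGloballyMinimal],
      (∃ C : VariableChange ℚ, C • W.quadraticTwist ((∏ q ∈ Q, qStar q : ℤ) : ℚ) = WM) →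
      (∃ C : VariableChange ℚ,
        C • W.quadraticTwist ((-(p : ℤ) * ∏ q ∈ Q, qStar q : ℤ) : ℚ) = WpM) →
        WM.analyticRank = 0 ∧ WM.mordellWeilRank = 0 ∧
        WpM.analyticRank = 1 ∧ WpM.mordellWeilRank = 1 ∧
        Finite WM.sha ∧ Finite WpM.sha

/-- **Shu–Zhai 2021, Corollary 1.3** (verbatim in the module docstring). For `E/ℚ` optimal
(globally minimal `W`, datum `Dt` with the lattice equality) with the standing `E[2](ℚ) ≅ ℤ/2ℤ`,
`f([0]) ∉ 2E(ℚ)`, and an odd prime `q ∤ N` of good reduction with `a_q ≡ 1 − (−1/q) (mod 4)`: for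
every `r ≥ 1` there are infinitely many square-free integers `M`, resp. `M′`, with exactly `r` prime
factors such that `L(E^{(M)},1) ≠ 0`, resp. `ord_{s=1} L(E^{(M′)},s) = 1` (stated on every globally
minimal model of the twist). AT 2. No `_holds` expected.
[cite: ShuZhai2021, Cor. 1.3 (arXiv:2102.11808 chunk p0003 L36–L38)] -/
def cor13_infinitely_many_twists : Prop :=
  ∀ (W : WeierstrassCurve ℚ) [W.IsElliptic] [W.IsGloballyMinimal] [NeZero (W.conductorNorm ℤ)]
    (Dt : ModularParametrizationData W (W.conductorNorm ℤ)),
    IsOptimalDatum W Dt → CuspZeroNotInTwice W Dt →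
    Nat.card {P : W.toAffine.Point // (2 : ℕ) • P = 0} = 2 →
    (∃ q : ℕ, q.Prime ∧ q ≠ 2 ∧ ¬ q ∣ W.conductorNorm ℤ ∧ SatisfiesHecke W q) →
    ∀ r : ℕ, 1 ≤ r →
      {M : ℤ | Squarefree M ∧ M.natAbs.primeFactors.card = r ∧
          ∀ (WM : WeierstrassCurve ℚ) [WM.IsElliptic] [WM.IsGloballyMinimal],
            (∃ C : VariableChange ℚ, C • W.quadraticTwist (M : ℚ) = WM) →
              WM.entireLFunction 1 ≠ 0}.Infinite ∧
      {M' : ℤ | Squarefree M' ∧ M'.natAbs.primeFactors.card = r ∧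
          ∀ (WM' : WeierstrassCurve ℚ) [WM'.IsElliptic] [WM'.IsGloballyMinimal],
            (∃ C : VariableChange ℚ, C • W.quadraticTwist (M' : ℚ) = WM') →
              WM'.analyticRank = 1}.Infinite

/-- **Shu–Zhai 2021, Theorem 1.4** (verbatim in the module docstring). In the setting of Thm. 1.2
and additionally (i) the Manin constant `Dt.c` odd, (ii) every prime `ℓ ∣ 2N` split in `ℚ(√−p)`
and in `ℚ(√M)`: if the `2`-part of BSD holds for `E` (`pPartBSD W 2`) then it holds for `E^{(M)}`
and `E^{(−pM)}` (globally minimal models `WM`, `WpM`). AT 2, both ranks (rank one = `E^{(−pM)}`).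
No `_holds` expected.
[cite: ShuZhai2021, Thm. 1.4 (arXiv:2102.11808 chunk p0003 L44–L45)] -/
def thm14_twoPartBSD_of_twists : Prop :=
  ∀ (W : WeierstrassCurve ℚ) [W.IsElliptic] [W.IsGloballyMinimal] [NeZero (W.conductorNorm ℤ)]
    (Dt : ModularParametrizationData W (W.conductorNorm ℤ)) (W' : WeierstrassCurve ℚ) (p : ℕ)
    (Q : Finset ℕ), Thm12Setting W Dt W' p Q →
    ∀ (WM WpM : WeierstrassCurve ℚ) [WM.IsElliptic] [WM.IsGloballyMinimal] [WpM.IsElliptic]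
      [WpM.IsGloballyMinimal],
      (∃ C : VariableChange ℚ, C • W.quadraticTwist ((∏ q ∈ Q, qStar q : ℤ) : ℚ) = WM) →
      (∃ C : VariableChange ℚ,
        C • W.quadraticTwist ((-(p : ℤ) * ∏ q ∈ Q, qStar q : ℤ) : ℚ) = WpM) →
    -- (i) odd Manin constant; (ii) every `ℓ ∣ 2N` splits in `ℚ(√−p)` and in `ℚ(√M)`
    ¬ (2 : ℤ) ∣ Dt.c →
    AllPrimesSplitInSqrt (2 * W.conductorNorm ℤ) (-(p : ℤ)) →
    AllPrimesSplitInSqrt (2 * W.conductorNorm ℤ) (∏ q ∈ Q, qStar q) →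
      pPartBSD W 2 → pPartBSD WM 2 ∧ pPartBSD WpM 2

/-- **Shu–Zhai 2021, Theorem 4.10** (verbatim in the module docstring; the body of Thm. 1.4). In the
setting of Thm. 1.2 with all prime factors of `2N` split in `ℚ(√M)`, `p ≡ −1 (mod 8)` and odd Manin
constant, for globally minimal models `WM`, `WpM` of `E^{(M)}`, `E^{(−pM)}` (`r = #Q`):
ranks `0 = 0` and `1 = 1` as in Thm. 1.2; `ord₂(L(E^{(M)},1)/Ω_{E^{(M)}}) = r − 1`;
`ord₂(L′(E^{(−pM)},1)/(Ω_{E^{(−pM)}} R(E^{(−pM)}))) = r` (`leadingLCoeff = L′(·,1)` at analytic rank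
`1`, `R` = `regulator`); `Ш(E^{(M)})`, `Ш(E^{(−pM)})` finite of odd cardinality; and BSD(2) for `E`
implies BSD(2) for `E^{(M)}` and `E^{(−pM)}`. AT 2, both ranks, the valuations UNCONDITIONAL.
No `_holds` expected.
[cite: ShuZhai2021, Thm. 4.10 (arXiv:2102.11808 chunk p0013 L14–L26), (fbsd) (p0013 L6–L12)] -/
def thm410_twoAdicValuations_of_twists : Prop :=
  ∀ (W : WeierstrassCurve ℚ) [W.IsElliptic] [W.IsGloballyMinimal] [NeZero (W.conductorNorm ℤ)]
    (Dt : ModularParametrizationData W (W.conductorNorm ℤ)) (W' : WeierstrassCurve ℚ) (p : ℕ)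
    (Q : Finset ℕ), Thm12Setting W Dt W' p Q →
    AllPrimesSplitInSqrt (2 * W.conductorNorm ℤ) (∏ q ∈ Q, qStar q) → p % 8 = 7 →
    ¬ (2 : ℤ) ∣ Dt.c →
    ∀ (WM WpM : WeierstrassCurve ℚ) [WM.IsElliptic] [WM.IsGloballyMinimal] [WpM.IsElliptic]
      [WpM.IsGloballyMinimal],
      (∃ C : VariableChange ℚ, C • W.quadraticTwist ((∏ q ∈ Q, qStar q : ℤ) : ℚ) = WM) →
      (∃ C : VariableChange ℚ,
        C • W.quadraticTwist ((-(p : ℤ) * ∏ q ∈ Q, qStar q : ℤ) : ℚ) = WpM) →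
        (WM.analyticRank = 0 ∧ WM.mordellWeilRank = 0 ∧
          WpM.analyticRank = 1 ∧ WpM.mordellWeilRank = 1) ∧
        (∃ x : ℚ, WM.entireLFunction 1 = (x : ℂ) * (WM.realPeriodRat : ℂ) ∧
          padicValRat 2 x = (Q.card : ℤ) - 1) ∧
        (∃ x : ℚ, WpM.leadingLCoeff = (x : ℂ) * (WpM.realPeriodRat : ℂ) * (WpM.regulator : ℂ) ∧
          padicValRat 2 x = (Q.card : ℤ)) ∧
        (Finite WM.sha ∧ Odd (Nat.card WM.sha) ∧ Finite WpM.sha ∧ Odd (Nat.card WpM.sha)) ∧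
        (pPartBSD W 2 → pPartBSD WM 2 ∧ pPartBSD WpM 2)

/-! ### §3. Bookkeeping (proved) -/

/-- `q* = q` for `q ≡ 1 (mod 4)`. [cite: ShuZhai2021, §1 (chunk p0003 L22)] -/
theorem qStar_of_mod_four_eq_one {q : ℕ} (h : q % 4 = 1) : qStar q = q := by
  simp [qStar, h]

/-- `q* = −q` for `q ≡ 3 (mod 4)`. [cite: ShuZhai2021, §1 (chunk p0003 L22)] -/
theorem qStar_of_mod_four_eq_three {q : ℕ} (h : q % 4 = 3) : qStar q = -q := by
  simp [qStar, h]

/-- For `Q = ∅` (`r = 0`, `M = 1`) the `ℚ(√M)`-splitting condition of Thm. 1.4 / Thm. 4.10 is empty.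
[cite: ShuZhai2021, Thm. 1.2 ("for any integer r ≥ 0", chunk p0003 L25)] -/
theorem allPrimesSplitInSqrt_prod_empty (n : ℕ) :
    AllPrimesSplitInSqrt n (∏ q ∈ (∅ : Finset ℕ), qStar q) :=
  Or.inl ⟨1, by simp⟩

/-- Thm. 4.10 contains Thm. 1.4: hypothesis (ii) of Thm. 1.4 at the prime `2 ∣ 2N` forces `2` to split
in `ℚ(√−p)`, which for `p ≡ 3 (mod 4)` means `p ≡ 7 (mod 8)`; granted that implication (the binder
`h2`), the BSD(2) transport of Thm. 1.4 is the last clause of Thm. 4.10.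
[cite: ShuZhai2021, Thm. 1.4 and Thm. 4.10 (chunks p0003 L44–L45, p0013 L14–L26)] -/
theorem thm14_of_thm410 (h410 : thm410_twoAdicValuations_of_twists)
    (h2 : ∀ (N p : ℕ), p % 4 = 3 → AllPrimesSplitInSqrt (2 * N) (-(p : ℤ)) → p % 8 = 7) :
    thm14_twoPartBSD_of_twists := by
  intro W _ _ _ Dt W' p Q hS WM WpM _ _ _ _ hM hpM hc hK hQM hBSD
  have hp7 : p % 8 = 7 := h2 (W.conductorNorm ℤ) p hS.2.2.2.2.2.2.2.1 hK
  exact (h410 W Dt W' p Q hS hQM hp7 hc WM WpM hM hpM).2.2.2.2 hBSD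

end Literature.NumberTheory.EllipticCurves.ShuZhai2021

end
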